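import Mathlib
import HarnessLib
import Literature.Probability.MarkovChains.LogSobolevConstant

/-!
# The logarithmic Sobolev constant of the symmetric two-point space is `1/2` (Saloff-Coste 1997, Theorem 2.2.8 at `θ = 1/2`; Bonami, Gross)

HONEST FRAMING: exact (Metropolis-corrected) sampling algorithms for lattice gauge theory; figures
of merit are autocorrelation/cost numbers at stated couplings and volumes; no continuum-physics claim.

[Saloffcoste1997] §2.2.2, Example 2.2.1 / THEOREM 2.2.8: on `X = {0,1}` the chain `K_θ` reversible for
`π_θ` has `α_θ = (1 − 2θ)/log[(1 − θ)/θ]`, "with `α_{1/2} = 1/2`"; "The case `θ = 1/2` is due to Aline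
Bonami [10] and is well known since the work of L. Gross [46]."  This file proves the case `θ = 1/2`
— the symmetric two-point space `π ≡ 1/2`, `K ≡ 1/2`, where `𝓔(f,f) = (f(0) − f(1))²/4` and
`𝓛(f) = ½f(0)² log(f(0)²/‖f‖²) + ½f(1)² log(f(1)²/‖f‖²)`, `‖f‖² = (f(0)² + f(1)²)/2`:

* `twoPoint_mul_log_le` — the TWO-POINT INEQUALITY `𝓛(f) ≤ (f(0) − f(1))²/2`, i.e. `½𝓛 ≤ 𝓔`, for
  all real `f(0), f(1)`; by homogeneity and `f ↦ |f|` it is the one-variable inequality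
  `½x² log(2x²/(1+x²)) + ½ log(2/(1+x²)) ≤ (x−1)²/2` (`x > 0`), proved by two monotonicity passes:
  with `F(x)` the difference, `F(1) = F′(1) = 0` and `F″(x) = w − 1 − log w ≥ 0`, `w = 2x²/(1+x²)`
  (`twoPoint_aux`);
* `Saloffcoste1997_thm_2_2_8_half` — **`α = 1/2`**: `≥` from the two-point inequality and the
  maximality of `α` (`le_logSobolevConst`), `≤` from LEMMA 2.2.2 (`2α ≤ λ`) and `λ ≤ 𝓔(f,f) = 1` at the
  normalised mean-zero `f = (1, −1)`.

The general `θ` (Bobkov's argument printed in [Saloffcoste1997], or [DiaconisSaloffcoste1996] Thm. A.2)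
and THEOREM 2.2.9 / COROLLARY 2.2.10 (`α ≥ (1 − 2π_*)λ/log[(1 − π_*)/π_*]`) are NOT formalized here.
-/

namespace Literature.Probability.MarkovChains

open Finset Matrix

/-! ## The one-variable inequality -/

/-- `½x² log(2x²/(1+x²)) + ½ log(2/(1+x²)) ≤ (x−1)²/2` for `x > 0`: with `F` the difference `RHS − LHS`,
`F(1) = 0`, `F′(x) = (x − 1) − x log(2x²/(1+x²))` vanishes at `1` and is non-decreasing since
`F″(x) = w − 1 − log w ≥ 0` where `w = 2x²/(1+x²)` (`log w ≤ w − 1`). [cite: Saloffcoste1997, §2.2.2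
Theorem 2.2.8 (the case `θ = 1/2`, "due to Aline Bonami [10] … L. Gross [46]")] -/
theorem twoPoint_aux {x : ℝ} (hx : 0 < x) :
    (1 / 2) * (x ^ 2 * Real.log (2 * x ^ 2 / (1 + x ^ 2))) + (1 / 2) * Real.log (2 / (1 + x ^ 2))
      ≤ (x - 1) ^ 2 / 2 := by
  set g : ℝ → ℝ := fun u => 2 * u ^ 2 / (1 + u ^ 2) with hg
  set χ : ℝ → ℝ := fun u => (u - 1) - u * Real.log (g u) with hχ
  set ψ : ℝ → ℝ := fun u => (u - 1) ^ 2 / 2 - (1 / 2) * (u ^ 2 * Real.log (g u))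
    - (1 / 2) * Real.log (2 / (1 + u ^ 2)) with hψ
  have h1u : ∀ u : ℝ, 0 < 1 + u ^ 2 := fun u => by positivity
  have hgpos : ∀ u : ℝ, 0 < u → 0 < g u := fun u hu => by simp only [hg]; positivity
  -- derivatives of the two logarithms
  have hlogg : ∀ u : ℝ, 0 < u → HasDerivAt (fun u => Real.log (g u)) (2 / (u * (1 + u ^ 2))) u := by
    intro u hu
    have hnum : HasDerivAt (fun u : ℝ => 2 * u ^ 2) (2 * (((2 : ℕ) : ℝ) * u ^ (2 - 1) * 1)) u :=
      ((hasDerivAt_id u).pow 2).const_mul 2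
    have hden : HasDerivAt (fun u : ℝ => 1 + u ^ 2) (0 + ((2 : ℕ) : ℝ) * u ^ (2 - 1) * 1) u :=
      (hasDerivAt_const u 1).add ((hasDerivAt_id u).pow 2)
    have hquot := hnum.div hden (h1u u).ne'
    have hl := hquot.log (by simp only [Pi.div_apply]; exact (hgpos u hu).ne')
    refine hl.congr_deriv ?_
    simp only [Pi.div_apply]
    have hu' : u ≠ 0 := hu.ne'
    have h1 : (1 + u ^ 2) ≠ 0 := (h1u u).ne'
    field_simp
    ring
  have hlog2 : ∀ u : ℝ, HasDerivAt (fun u => Real.log (2 / (1 + u ^ 2))) (-(2 * u) / (1 + u ^ 2)) u := by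
    intro u
    have hden : HasDerivAt (fun u : ℝ => 1 + u ^ 2) (0 + ((2 : ℕ) : ℝ) * u ^ (2 - 1) * 1) u :=
      (hasDerivAt_const u 1).add ((hasDerivAt_id u).pow 2)
    have hquot := (hasDerivAt_const u (2 : ℝ)).div hden (h1u u).ne'
    have hl := hquot.log (by simp only [Pi.div_apply]; positivity)
    refine hl.congr_deriv ?_
    simp only [Pi.div_apply]
    have h1 : (1 + u ^ 2) ≠ 0 := (h1u u).ne'
    field_simp
    ring
  have hχd : ∀ u : ℝ, 0 < u → HasDerivAt χ (1 - Real.log (g u) - 2 / (1 + u ^ 2)) u := by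
    intro u hu
    have h2 : HasDerivAt (fun u : ℝ => u - 1) 1 u := (hasDerivAt_id u).sub_const 1
    have h3 : HasDerivAt (fun u : ℝ => u * Real.log (g u))
        (1 * Real.log (g u) + u * (2 / (u * (1 + u ^ 2)))) u := (hasDerivAt_id u).mul (hlogg u hu)
    have h := h2.sub h3
    refine h.congr_deriv ?_
    have hu' : u ≠ 0 := hu.ne'
    have h1 : (1 + u ^ 2) ≠ 0 := (h1u u).ne'
    field_simp
    ring
  have hψd : ∀ u : ℝ, 0 < u → HasDerivAt ψ (χ u) u := by
    intro u hu
    have h2 : HasDerivAt (fun u : ℝ => u - 1) 1 u := (hasDerivAt_id u).sub_const 1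
    have h2' : HasDerivAt (fun u : ℝ => (u - 1) ^ 2 / 2) (((2 : ℕ) : ℝ) * (u - 1) ^ (2 - 1) * 1 / 2) u :=
      (h2.pow 2).div_const 2
    have h3 : HasDerivAt (fun u : ℝ => (1 / 2) * (u ^ 2 * Real.log (g u)))
        ((1 / 2) * (((2 : ℕ) : ℝ) * u ^ (2 - 1) * 1 * Real.log (g u)
          + u ^ 2 * (2 / (u * (1 + u ^ 2))))) u :=
      (((hasDerivAt_id u).pow 2).mul (hlogg u hu)).const_mul (1 / 2)
    have h4 : HasDerivAt (fun u : ℝ => (1 / 2) * Real.log (2 / (1 + u ^ 2)))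
        ((1 / 2) * (-(2 * u) / (1 + u ^ 2))) u := (hlog2 u).const_mul (1 / 2)
    have h := (h2'.sub h3).sub h4
    refine h.congr_deriv ?_
    simp only [hχ]
    have hu' : u ≠ 0 := hu.ne'
    have h1 : (1 + u ^ 2) ≠ 0 := (h1u u).ne'
    push_cast
    field_simp
    ring
  have hχ1 : χ 1 = 0 := by simp [hχ, hg]; norm_num
  have hψ1 : ψ 1 = 0 := by simp [hψ, hg]; norm_num
  -- `χ′ = w − 1 − log w ≥ 0`
  have hχ'nonneg : ∀ u : ℝ, 0 < u → 0 ≤ 1 - Real.log (g u) - 2 / (1 + u ^ 2) := by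
    intro u hu
    have hw : 2 / (1 + u ^ 2) = 2 - g u := by
      simp only [hg]
      have h1 : (1 + u ^ 2) ≠ 0 := (h1u u).ne'
      field_simp
      ring
    rw [hw]
    have := Real.log_le_sub_one_of_pos (hgpos u hu)
    linarith
  have hχmono : MonotoneOn χ (Set.Ioi 0) := by
    refine monotoneOn_of_deriv_nonneg (convex_Ioi 0) ?_ ?_ ?_
    · exact fun u hu => (hχd u hu).continuousAt.continuousWithinAt
    · rw [interior_Ioi]
      exact fun u hu => (hχd u hu).differentiableAt.differentiableWithinAt
    · rw [interior_Ioi]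
      intro u hu
      rw [(hχd u hu).deriv]
      exact hχ'nonneg u hu
  have hψanti : AntitoneOn ψ (Set.Ioc 0 1) := by
    refine antitoneOn_of_deriv_nonpos (convex_Ioc 0 1) ?_ ?_ ?_
    · exact fun u hu => (hψd u hu.1).continuousAt.continuousWithinAt
    · rw [interior_Ioc]
      exact fun u hu => (hψd u hu.1).differentiableAt.differentiableWithinAt
    · rw [interior_Ioc]
      intro u hu
      rw [(hψd u hu.1).deriv, ← hχ1]
      exact hχmono (Set.mem_Ioi.2 hu.1) (Set.mem_Ioi.2 one_pos) hu.2.le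
  have hψmono : MonotoneOn ψ (Set.Ici 1) := by
    refine monotoneOn_of_deriv_nonneg (convex_Ici 1) ?_ ?_ ?_
    · exact fun u hu => (hψd u (lt_of_lt_of_le one_pos hu)).continuousAt.continuousWithinAt
    · rw [interior_Ici]
      exact fun u hu => (hψd u (lt_trans one_pos hu)).differentiableAt.differentiableWithinAt
    · rw [interior_Ici]
      intro u hu
      rw [(hψd u (lt_trans one_pos hu)).deriv, ← hχ1]
      exact hχmono (Set.mem_Ioi.2 one_pos) (Set.mem_Ioi.2 (lt_trans one_pos hu)) (le_of_lt hu)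
  have hψx : 0 ≤ ψ x := by
    rcases le_or_gt x 1 with hle | hgt
    · rw [← hψ1]
      exact hψanti ⟨hx, hle⟩ ⟨one_pos, le_rfl⟩ hle
    · rw [← hψ1]
      exact hψmono (Set.mem_Ici.2 le_rfl) (Set.mem_Ici.2 hgt.le) hgt.le
  have e : ψ x = (x - 1) ^ 2 / 2 - ((1 / 2) * (x ^ 2 * Real.log (2 * x ^ 2 / (1 + x ^ 2)))
      + (1 / 2) * Real.log (2 / (1 + x ^ 2))) := by
    simp only [hψ, hg]; ring
  rw [e] at hψx
  linarith

/-- `log 2 ≤ 1` (the boundary case `x = 0` / one vanishing value). [folklore] -/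
private theorem log_two_le_one : Real.log 2 ≤ 1 := by
  have := Real.log_le_sub_one_of_pos (zero_lt_two' ℝ)
  linarith

/-- The two-point inequality for non-negative values, scaled form: for `x ≥ 0 < t`,
`½(xt)² log((xt)²/m) + ½t² log(t²/m) ≤ (xt − t)²/2`, `m = ((xt)² + t²)/2`.
[cite: Saloffcoste1997, §2.2.2 Theorem 2.2.8 (`θ = 1/2`)] -/
private theorem twoPoint_scaled {x t : ℝ} (hx : 0 ≤ x) (ht : 0 < t) :
    (1 / 2) * ((x * t) ^ 2 * Real.log ((x * t) ^ 2 / (((x * t) ^ 2 + t ^ 2) / 2)))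
      + (1 / 2) * (t ^ 2 * Real.log (t ^ 2 / (((x * t) ^ 2 + t ^ 2) / 2)))
      ≤ (x * t - t) ^ 2 / 2 := by
  have ht2 : 0 < t ^ 2 := by positivity
  have h1x : 0 < 1 + x ^ 2 := by positivity
  have e1 : (x * t) ^ 2 / (((x * t) ^ 2 + t ^ 2) / 2) = 2 * x ^ 2 / (1 + x ^ 2) := by
    field_simp
    ring
  have e2 : t ^ 2 / (((x * t) ^ 2 + t ^ 2) / 2) = 2 / (1 + x ^ 2) := by
    field_simp
    ring
  rw [e1, e2]
  rcases hx.eq_or_lt with h0 | hxpos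
  · -- `x = 0`: `½t² log 2 ≤ t²/2`
    rw [← h0]
    simp only [zero_mul, ne_eq, OfNat.ofNat_ne_zero, not_false_eq_true, zero_pow, mul_zero,
      zero_div, zero_add, zero_sub, even_two, Even.neg_pow]
    nlinarith [log_two_le_one, ht2]
  · have h := twoPoint_aux hxpos
    have := mul_le_mul_of_nonneg_left h ht2.le
    have e3 : (x * t - t) ^ 2 / 2 = t ^ 2 * ((x - 1) ^ 2 / 2) := by ring
    rw [e3]
    linarith [this]

/-- **The two-point logarithmic Sobolev inequality** (Bonami–Gross): for all real `s, t`, with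
`m = (s² + t²)/2`, `½s² log(s²/m) + ½t² log(t²/m) ≤ (s − t)²/2` — i.e. `𝓛(f) ≤ 2𝓔(f,f)` on the
symmetric two-point space. [cite: Saloffcoste1997, §2.2.2 Theorem 2.2.8 (`α_{1/2} = 1/2`)] -/
theorem twoPoint_mul_log_le (s t : ℝ) :
    (1 / 2) * (s ^ 2 * Real.log (s ^ 2 / ((s ^ 2 + t ^ 2) / 2)))
      + (1 / 2) * (t ^ 2 * Real.log (t ^ 2 / ((s ^ 2 + t ^ 2) / 2))) ≤ (s - t) ^ 2 / 2 := by
  -- reduce to `|s|, |t|`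
  have key : ∀ a b : ℝ, 0 ≤ a → 0 ≤ b →
      (1 / 2) * (a ^ 2 * Real.log (a ^ 2 / ((a ^ 2 + b ^ 2) / 2)))
        + (1 / 2) * (b ^ 2 * Real.log (b ^ 2 / ((a ^ 2 + b ^ 2) / 2))) ≤ (a - b) ^ 2 / 2 := by
    intro a b ha hb
    rcases hb.eq_or_lt with hb0 | hbpos
    · rcases ha.eq_or_lt with ha0 | hapos
      · rw [← ha0, ← hb0]; simp
      · -- `b = 0 < a`: swap the roles, `x = 0`
        have h := twoPoint_scaled le_rfl hapos
        simp only [zero_mul] at h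
        rw [← hb0]
        have e : (a - 0) ^ 2 / 2 = (0 - a) ^ 2 / 2 := by ring
        rw [e]
        simpa [add_comm] using h
    · have h := twoPoint_scaled (div_nonneg ha hbpos.le) hbpos
      rwa [div_mul_cancel₀ a hbpos.ne'] at h
  have h := key |s| |t| (abs_nonneg s) (abs_nonneg t)
  rw [sq_abs, sq_abs] at h
  refine h.trans ?_
  have h2 : (|s| - |t|) ^ 2 ≤ (s - t) ^ 2 := by
    rw [← sq_abs (|s| - |t|), ← sq_abs (s - t)]
    exact pow_le_pow_left₀ (abs_nonneg _) (abs_abs_sub_abs_le_abs_sub s t) 2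
  linarith

/-! ## The symmetric two-point chain -/

/-- The uniform law on the two-point space, `π ≡ 1/2`. [cite: Saloffcoste1997, §2.2.2 Example 2.2.1
(`θ = 1/2`)] -/
noncomputable def twoPointPi : Fin 2 → ℝ := fun _ => 1 / 2

/-- The symmetric two-point kernel `K ≡ 1/2` (`K(x,·) = π`). [cite: Saloffcoste1997, §2.2.2
Example 2.2.1 (`θ = 1/2`)] -/
noncomputable def twoPointKernel : Matrix (Fin 2) (Fin 2) ℝ := fun _ _ => 1 / 2

/-- `π(x) = 1/2`. [cite: Saloffcoste1997, §2.2.2 Example 2.2.1 (`θ = 1/2`)] -/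
@[simp] theorem twoPointPi_apply (x : Fin 2) : twoPointPi x = 1 / 2 := rfl

/-- `K(x,y) = 1/2`. [cite: Saloffcoste1997, §2.2.2 Example 2.2.1 (`θ = 1/2`)] -/
@[simp] theorem twoPointKernel_apply (x y : Fin 2) : twoPointKernel x y = 1 / 2 := rfl

/-- `𝓔(f,f) = (f(0) − f(1))²/4` ("`𝓔_θ(f,f) = θ(1−θ)|f(0) − f(1)|²`" at `θ = 1/2`).
[cite: Saloffcoste1997, §2.2.2 Theorem 2.2.8 (proof)] -/
theorem dirichletForm_twoPoint (f : Fin 2 → ℝ) :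
    dirichletForm twoPointPi twoPointKernel f = (f 0 - f 1) ^ 2 / 4 := by
  unfold dirichletForm
  simp [Fin.sum_univ_two]
  ring

/-- `‖f‖²_π = (f(0)² + f(1)²)/2`. [cite: Saloffcoste1997, §2.2.2 Example 2.2.1] -/
theorem piInner_twoPoint (f : Fin 2 → ℝ) :
    piInner twoPointPi f f = (f 0 ^ 2 + f 1 ^ 2) / 2 := by
  unfold piInner
  simp [Fin.sum_univ_two]
  ring

/-- `𝓛(f) = ½f(0)² log(f(0)²/‖f‖²) + ½f(1)² log(f(1)²/‖f‖²)`. [cite: Saloffcoste1997, §2.2.2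
Example 2.2.1] -/
theorem entForm_twoPoint (f : Fin 2 → ℝ) :
    entForm twoPointPi f = (1 / 2) * (f 0 ^ 2 * Real.log (f 0 ^ 2 / ((f 0 ^ 2 + f 1 ^ 2) / 2)))
      + (1 / 2) * (f 1 ^ 2 * Real.log (f 1 ^ 2 / ((f 0 ^ 2 + f 1 ^ 2) / 2))) := by
  unfold entForm
  rw [piInner_twoPoint]
  simp [Fin.sum_univ_two]

/-- **`½𝓛(f) ≤ 𝓔(f,f)` on the symmetric two-point space** (the log-Sobolev inequality with constant
`1/2`). [cite: Saloffcoste1997, §2.2.2 Theorem 2.2.8 (`α_{1/2} = 1/2`)] -/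
theorem twoPoint_logSobolev (f : Fin 2 → ℝ) :
    (1 / 2) * entForm twoPointPi f ≤ dirichletForm twoPointPi twoPointKernel f := by
  rw [entForm_twoPoint, dirichletForm_twoPoint]
  have := twoPoint_mul_log_le (f 0) (f 1)
  linarith

/-- **THEOREM 2.2.8 (`θ = 1/2`): the log-Sobolev constant of the symmetric two-point space is `1/2`**
("with `α_{1/2} = 1/2`"; here `2α ≤ λ ≤ 𝓔(f,f) = 1` at `f = (1,−1)` gives `≤`).
[cite: Saloffcoste1997, §2.2.2 Theorem 2.2.8] -/
theorem Saloffcoste1997_thm_2_2_8_half : logSobolevConst twoPointPi twoPointKernel = 1 / 2 := by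
  have hπ : ∀ x, 0 < twoPointPi x := fun x => by simp
  have hπ1 : ∑ x, twoPointPi x = 1 := by norm_num [Fin.sum_univ_two]
  have hK : ∀ x y, 0 ≤ twoPointKernel x y := fun x y => by simp
  refine le_antisymm ?_ ?_
  · -- `2α ≤ λ ≤ 𝓔(f) = 1` for `f = (1, −1)`
    have h2 := Saloffcoste1997_lemma_2_2_2 hπ hπ1 hK
    set f : Fin 2 → ℝ := ![1, -1] with hf
    have hf0 : ∑ x, twoPointPi x * f x = 0 := by simp [Fin.sum_univ_two, hf]
    have hf1 : piInner twoPointPi f f = 1 := by rw [piInner_twoPoint]; norm_num [hf]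
    have h3 := spectralGapR_le_dirichletForm (fun x => (hπ x).le) hK hf0 hf1
    rw [dirichletForm_twoPoint] at h3
    simp [hf] at h3
    linarith
  · classical
    obtain ⟨f₀, hf₀⟩ := exists_entForm_pos hπ hπ1
    exact le_logSobolevConst hπ hπ1 (fun f => twoPoint_logSobolev f) ⟨f₀, hf₀.ne'⟩

end Literature.Probability.MarkovChains
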